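/-
Copyright (c) 2026 the pub-hodgecm-mathlib formalisation cell (harness21).  Prover seat hodgecm-mathlib-R90-C10-p08 (g0) (free S1 hand), HCML SLAB R90-TF,
section S6 «Ch. 14.1–14.5 stable trace formula» (base `R90-C14`), S6 WAVE 5 card W5-c (R90-C14-plan (g0) W5 DEAL 22:05:19Z, dealt by name 22:06:14Z).  2026-09-04.
-/
import Summits.HodgeConjecture.HodgeConjecture.Theorems.R90S6SatakeGraphPartnerHom                 -- ★ W4 (R90-C14-p03): `satakeGraphPartnerAlgHom`, `graph_satakeGraphPartnerAlgHom`, `satakeGraphPartner_graph`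
import Summits.HodgeConjecture.HodgeConjecture.Theorems.R90S6SatakeGraphPartnerSurjective          -- ★ W5-a (K2E1-p10, p862432): `satakeGraph_partner_surjective`
import Summits.HodgeConjecture.HodgeConjecture.Theorems.R90S6HeckeSeparatedByEigencharacterThree   -- ★ W5-b′ (R90-C14-p01, p862386): `hecke_eq_of_partner_eigencharacter_eq`
import HarnessLib

/-!
# R90 · S6 — WAVE 5 card W5-c: the SATAKE-GRAPH PARTNER MAP IS A ℂ-ALGEBRA ISOMORPHISM
# `b_w : ℋ(U(J₀,3)(E_w), K₀) ≃ₐ[ℂ] ℋ(U(J₀,2)(E_w), K₀)` at an inert unramified place (`Theorems/R90S6SatakeGraphPartnerAlgEquiv.lean`)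

Cell `hodgecm-mathlib`, crux H413 (`stmt-HodgeConjecture-24833`), route of record `HCCMUnconditional`; programme R90-TF, section S6 (base `R90-C14`,
dealer R90-C14-plan (g0)), seat R90-C10-p08 (g0); card W5-c (W5 DEAL 22:05:19Z «upgrade `satakeGraphPartnerAlgHom` to an `AlgEquiv` from W5-a + W3-b»,
dealt by name 22:06:14Z with the decl list `satakeGraphPartnerAlgEquiv` ∕ `_apply` ∕ `graph_satakeGraphPartnerAlgEquiv` ∕ `_symm_graph`).  Supply for FILE D
§ (E1-c) `SatakeGraph` ∕ `StubR90ExtE1HeckeFL` consumers and the S6 ED. 2b Hecke variation in the two-place frame; pays no socket by itself.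
Helper lane `--supports stmt-HodgeConjecture-24833 --as helper`; ONE definition (`satakeGraphPartnerAlgEquiv`, an `AlgEquiv.ofBijective` packaging — no
new mathematics-bearing `def`), no instance, no notation, no `sorry`; imports = the three ★ S6 Theorems files it composes (Theorems may import Theorems) + HarnessLib.

THE MATHEMATICS [Rogawski1990, §4.9 Prop. 4.9.1 p. 55; §4.5 p. 55; CartierCorvallis1979, §IV Thm. 4.1, Cor. 4.2].  `b_w = ξ̂_H : ℋ_G → ℋ_H` is the algebra
homomorphism characterised by `ξ̂_H(f)^∧(z) = f^∧(−z)` (★ W4 `satakeGraphPartnerAlgHom`, `graph_satakeGraphPartnerAlgHom`).  It is INJECTIVE because the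
unramified eigencharacters `z ↦ λ_{(−z,1,1)}` separate `ℋ_G` (★ W5-b′ `hecke_eq_of_partner_eigencharacter_eq`), and SURJECTIVE because every `φH ∈ ℋ_H` lies
on the graph of some `φ` (★ W5-a `satakeGraph_partner_surjective`) while the graph is functional (★ W3-b `satakeGraph_partner_unique`).  Hence
`b_w` is a ℂ-algebra isomorphism (both algebras are `ℂ[T₁]`; print: `ℋ_G ≅ ℋ_H ≅ ℂ[Z + Z⁻¹]`).
* `satakeGraphPartnerAlgHom_injective` ∕ `_surjective` ∕ `_bijective`;
* **`satakeGraphPartnerAlgEquiv`** `:= AlgEquiv.ofBijective (satakeGraphPartnerAlgHom …) …`, read-backs `satakeGraphPartnerAlgEquiv_apply` (`= satakeGraphPartner … φ`,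
  rfl), `toAlgHom_satakeGraphPartnerAlgEquiv` (rfl);
* **`graph_satakeGraphPartnerAlgEquiv`** `λ_{(z,1)}(b_w φ) = λ_{(−z,1,1)}(φ)` and **`satakeGraphPartnerAlgEquiv_symm_graph`** `λ_{(−z,1,1)}(b_w⁻¹ φH) = λ_{(z,1)}(φH)`.
ELABORATION: no `rw` with eigencharacter patterns on these carriers (keyed matching unifies the big Hecke-algebra types and times out at default heartbeats);
explicit `Eq.trans` ∕ `congrArg` chains, DEFAULT heartbeats throughout.
HONEST LABEL: local spherical Hecke algebra bookkeeping; proves no printed global statement and discharges no citation.  HC_CM is proved only modulo the 7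
printed citations (2 remaining named inputs: hLiu418 = stmt-HodgeConjecture-24832, h413 = stmt-HodgeConjecture-24833) until rung 0 closes; REL ≠ ★ ≠ BUILT;
count-neutral helper.

## References
* [Rogawski1990] J. D. Rogawski, *Automorphic Representations of Unitary Groups in Three Variables*, Ann. of Math. Stud. 123 (1990), §4.9 Prop. 4.9.1 p. 55
  (`b : ℋ_G → ℋ_H`), §4.5 p. 55 (`ξ̂_H(f)^∧(z) = f^∧(−z)`), §4.5 p. 50 (unramified `λ_β`).
* [CartierCorvallis1979] P. Cartier, *Representations of 𝔭-adic groups: a survey*, PSPM 33.1 (1979), §IV Thm. 4.1, Cor. 4.2.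
* [Minguez2011] A. Mínguez, *Unramified representations of unitary groups*, in *On the stabilization of the trace formula* (2011), §4.
-/

set_option autoImplicit false
-- the mandated namespace repeats the single-problem summit's segment (`HodgeConjecture.HodgeConjecture`)
set_option linter.dupNamespace false

noncomputable section

open NumberField IsDedekindDomain
open Literature.NumberTheory.Automorphic Literature.NumberTheory.Automorphic.HermitianLattice Literature.NumberTheory.Automorphic.UnitaryGroup

namespace Summit.HodgeConjecture.HodgeConjecture.R90.S6

variable {F E : Type} [Field F] [NumberField F] [Field E] [NumberField E] [Algebra F E] [Algebra.IsQuadraticExtension F E]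
  (c : E ≃ₐ[F] E) (hc1 : c ≠ 1) (v : HeightOneSpectrum (𝓞 F)) (w : PlacesOver E v) (hw : c • w.1 = w.1)
  (hv : Algebra.IsUnramifiedIn (𝓞 E) v.asIdeal)

/-- **`b_w` is injective**: the unramified eigencharacters `z ↦ λ_{(−z,1,1)}` separate `ℋ(U(J₀,3)(E_w), K₀)` (★ W5-b′
`hecke_eq_of_partner_eigencharacter_eq`) and `b_w` lies on the Satake graph (★ W4 `graph_satakeGraphPartnerAlgHom`).
[cite: Rogawski1990, §4.9 Prop. 4.9.1 p. 55] [cite: CartierCorvallis1979, §IV Thm. 4.1, Cor. 4.2] -/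
theorem satakeGraphPartnerAlgHom_injective : Function.Injective (satakeGraphPartnerAlgHom c hc1 v w hw hv) := fun φ φ' h =>
  hecke_eq_of_partner_eigencharacter_eq c hc1 v w hw hv φ φ' fun z =>
    ((graph_satakeGraphPartnerAlgHom c hc1 v w hw hv φ z).symm.trans
      (congrArg (fun x => unitaryHeckeEigencharacterAdic c hc1 v w hw hv ![z, 1] x) h)).trans (graph_satakeGraphPartnerAlgHom c hc1 v w hw hv φ' z)

/-- **`b_w` is surjective**: every `φH ∈ ℋ(U(J₀,2)(E_w), K₀)` lies on the graph of some `φ` (★ W5-a `satakeGraph_partner_surjective`) and the graph is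
functional (★ W3-b `satakeGraph_partner_unique`). [cite: Rogawski1990, §4.9 Prop. 4.9.1 p. 55] [cite: CartierCorvallis1979, §IV Thm. 4.1, Cor. 4.2] -/
theorem satakeGraphPartnerAlgHom_surjective : Function.Surjective (satakeGraphPartnerAlgHom c hc1 v w hw hv) := by
  intro φH
  obtain ⟨φ, hφ⟩ := satakeGraph_partner_surjective c hc1 v w hw hv φH
  exact ⟨φ, satakeGraph_partner_unique c hc1 v w hw hv (satakeGraphPartnerAlgHom c hc1 v w hw hv φ) φH fun z =>
    (graph_satakeGraphPartnerAlgHom c hc1 v w hw hv φ z).trans (hφ z).symm⟩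

/-- **`b_w` is bijective.** [cite: Rogawski1990, §4.9 Prop. 4.9.1 p. 55] -/
theorem satakeGraphPartnerAlgHom_bijective : Function.Bijective (satakeGraphPartnerAlgHom c hc1 v w hw hv) :=
  ⟨satakeGraphPartnerAlgHom_injective c hc1 v w hw hv, satakeGraphPartnerAlgHom_surjective c hc1 v w hw hv⟩

/-- **W5-c — the Satake-graph partner as a ℂ-ALGEBRA ISOMORPHISM `b_w : ℋ(U(J₀,3)(E_w), K₀) ≃ₐ[ℂ] ℋ(U(J₀,2)(E_w), K₀)`** (print's `ξ̂_H`,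
[Rogawski1990, §4.9 Prop. 4.9.1 p. 55]): `AlgEquiv.ofBijective` of ★ W4 `satakeGraphPartnerAlgHom`.
[cite: Rogawski1990, §4.9 Prop. 4.9.1 p. 55] [cite: CartierCorvallis1979, §IV Thm. 4.1, Cor. 4.2] -/
def satakeGraphPartnerAlgEquiv :
    heckeAlgebra ℂ ↥(unitaryGroupOfForm (galAdicCompletionMap (L := E) c hw) ((StdForm.antidiagonal 3).over (w.1.adicCompletion E)))
        (unitaryInt (galAdicCompletionMap (L := E) c hw) ((StdForm.antidiagonal 3).over (w.1.adicCompletion E))) ≃ₐ[ℂ]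
      heckeAlgebra ℂ ↥(unitaryGroupOfForm (galAdicCompletionMap (L := E) c hw) ((StdForm.antidiagonal 2).over (w.1.adicCompletion E)))
        (unitaryInt (galAdicCompletionMap (L := E) c hw) ((StdForm.antidiagonal 2).over (w.1.adicCompletion E))) :=
  AlgEquiv.ofBijective (satakeGraphPartnerAlgHom c hc1 v w hw hv) (satakeGraphPartnerAlgHom_bijective c hc1 v w hw hv)

/-- Read-back: on elements the isomorphism is `φ ↦ φ^H` (definitional). [cite: Rogawski1990, §4.5 p. 55] -/
theorem satakeGraphPartnerAlgEquiv_apply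
    (φ : heckeAlgebra ℂ ↥(unitaryGroupOfForm (galAdicCompletionMap (L := E) c hw) ((StdForm.antidiagonal 3).over (w.1.adicCompletion E)))
      (unitaryInt (galAdicCompletionMap (L := E) c hw) ((StdForm.antidiagonal 3).over (w.1.adicCompletion E)))) :
    satakeGraphPartnerAlgEquiv c hc1 v w hw hv φ = satakeGraphPartner c hc1 v w hw hv φ := rfl

/-- Read-back: the underlying algebra hom is ★ W4 `satakeGraphPartnerAlgHom` (definitional). [cite: Rogawski1990, §4.9 p. 55] -/
theorem toAlgHom_satakeGraphPartnerAlgEquiv :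
    (satakeGraphPartnerAlgEquiv c hc1 v w hw hv).toAlgHom = satakeGraphPartnerAlgHom c hc1 v w hw hv := rfl

/-- **Graph law of the isomorphism** (the form (E1-c) consumers read): `λ^{(2)}_{(z,1)}(b_w φ) = λ^{(3)}_{(−z,1,1)}(φ)` for every `z ∈ ℂˣ`.
[cite: Rogawski1990, §4.5 p. 55; §4.9 p. 55] -/
theorem graph_satakeGraphPartnerAlgEquiv
    (φ : heckeAlgebra ℂ ↥(unitaryGroupOfForm (galAdicCompletionMap (L := E) c hw) ((StdForm.antidiagonal 3).over (w.1.adicCompletion E)))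
      (unitaryInt (galAdicCompletionMap (L := E) c hw) ((StdForm.antidiagonal 3).over (w.1.adicCompletion E)))) (z : ℂˣ) :
    unitaryHeckeEigencharacterAdic c hc1 v w hw hv ![z, 1] (satakeGraphPartnerAlgEquiv c hc1 v w hw hv φ) =
      unitaryHeckeEigencharacterAdic c hc1 v w hw hv ![-z, 1, 1] φ :=
  satakeGraphPartner_graph c hc1 v w hw hv φ z

/-- **Graph law of the INVERSE**: `λ^{(3)}_{(−z,1,1)}(b_w⁻¹ φH) = λ^{(2)}_{(z,1)}(φH)` for every `z ∈ ℂˣ` (mind the sign side).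
[cite: Rogawski1990, §4.5 p. 55; §4.9 p. 55] -/
theorem satakeGraphPartnerAlgEquiv_symm_graph
    (φH : heckeAlgebra ℂ ↥(unitaryGroupOfForm (galAdicCompletionMap (L := E) c hw) ((StdForm.antidiagonal 2).over (w.1.adicCompletion E)))
      (unitaryInt (galAdicCompletionMap (L := E) c hw) ((StdForm.antidiagonal 2).over (w.1.adicCompletion E)))) (z : ℂˣ) :
    unitaryHeckeEigencharacterAdic c hc1 v w hw hv ![-z, 1, 1] ((satakeGraphPartnerAlgEquiv c hc1 v w hw hv).symm φH) =
      unitaryHeckeEigencharacterAdic c hc1 v w hw hv ![z, 1] φH :=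
  (graph_satakeGraphPartnerAlgHom c hc1 v w hw hv ((satakeGraphPartnerAlgEquiv c hc1 v w hw hv).symm φH) z).symm.trans
    (congrArg (fun x => unitaryHeckeEigencharacterAdic c hc1 v w hw hv ![z, 1] x)
      (AlgEquiv.ofBijective_apply_symm_apply (satakeGraphPartnerAlgHom c hc1 v w hw hv)
        (satakeGraphPartnerAlgHom_bijective c hc1 v w hw hv) φH))

end Summit.HodgeConjecture.HodgeConjecture.R90.S6

end
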